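import Summits.RiemannHypothesis.RiemannHypothesis.Theorems.TiltedLandingLaw421R3Lens1Pinning

/-! # WindowBooks-v4 r2 — «SURVIVOR BOOKS»: the RE-SEEDED lineage tracker T2, the survivor-depth law SURV, and the (K) converter to the rate half
(r2 = docblock re-wrap only, decls byte-identical to v4 5697653f82b4021b; lens-2 g10; RSV-80 v4 per V4-PLAN-v1 4452e88e741b453b; direction (R4) of record (CA846)(3), constants of record (CA849): (c, aH, aY) = (1/2, budgetConst 0, halfBudget))

**Why v4 (v3 481e669e64b375fc is DEAD AS TYPED — crit-1 g7 CUT 48 «CAND-11 CERTIFIED at k = 2», design TE*):** v3 cashed tracked dissipation through the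
mass quotient FIT′ `E′₀ + aH ≤ c·mass′_k·(slack_½ − aY)`.  TE* (an in-band ROOF of 25 simple zeros lifted by an in-slab out-of-band cluster, above the seed
`c = i`) breaks it TWICE and frame-generically: (H-a) EXTINCTION — a net-lifted band-lowest has no admissible heir (T1″ needs `Im heir ≤ Im parent`), so
`mass′_k = 0` at charged `k ≥ 2`; (H-b) CARRIED ENERGY — after the 25 roof lineages MERGE DOWN onto `c`'s kid (26 → 1) one survivor carries 2.7·(Hs/s)² of
initial energy: conjunct 2 false at the ALIVE level `k = 1` for every `c < 2.72`.  (H-b) is a BOOKS defect (no constant and no tracker repairs a mass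
quotient); (H-a) is a tracker defect.  v4 repairs both: NO mass/energy quotient at all, and RE-SEEDING.

**T2 = T1″ + RE-SEED (§1).**  `popQ … 0` = all level-0 band states; `popQ … (j+1)` = the heirs (T1″ VERBATIM: nearest nested kid, else nearest adoptee from
below; ≤ 1 heir per member, `Im heir ≤ Im parent`) of the level-`j` members — and, ONLY IF every lineage ends there, the band-LOWEST state(s) of level `j+1`
(`reseedQ`, tree `IsLowest`).  (K) `popQ_nonempty_of_charged`: a charged level has a lowest band state, hence a tracked survivor — (H-a) is closed by
construction.  `descQ u` = the lineage of root `u` (per-root books for the bench; merges are counted per root there).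

**LAWS (§3, typed OPEN bench items).**  ★ SURV `SurvivorLawQ c aH`: at every charged `k`, EVERY survivor `w ∈ popQ k` lies at energy depth
`η²(Hs² − Im w²)/s² ≥ c·k − aH` below the ceiling (form `c·k`, not `c·(k+1)`: clause 9 puts every zero at `|Im| ≤ Hs` and `StColQ'` allows `Im = Hs`, so a
level-0 member may have depth 0).  Mechanism (why this is located content and not a bare cap): an unlifted zero — native OR lateral entrant — dissipates
`(η/(s·g_eff))²` energy units per level (`g_eff` = tilt + co-signed regular field at the zero; ≥ 1 at `|g_eff| ≤ η/s`), an entrant arriving at level `k` has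
drifted `k/|g|` and sunk accordingly, and an in-band lifter above height `y`, itself sinking, passes below `y` within `depth(y)` levels («shielding time ≤ own
depth»); there is no lifter above the ceiling (clause 9) and none outside the column for a central state (CUT 48 Q-high/Q-out).  BENCH (instr-1 g10 E13.4.9,
floats): SURV margin ≥ 0 on 5 282/5 284 legal-charged rows at c = 1 (two coarsest-mesh XS rows sink at .9926/.9941 of a level per level), so `c_max = .9925`
and the constants of record take `c = 1/2` (margin ≥ .49·k); TE*: +3.75·10⁵ (18 re-seeds, Σ influx 14.2).  ★ LIFT `ChargedLiftLawQ aY` = v3 VERBATIM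
(signed cumulative charged change of the lowest band height ≥ −aY, HEIGHT currency).  FIT⁗ `PurseFitQ c aH aY`: the closed-form purse inequality
`(η²Hs²/s² + aH)/c + 1 + aY ≤ slack_½` per legal charged frame (no tracker inside; at (1/2, 0, halfBudget) ⟺ `Hs²/(2s²)·4η² … ≤ slack0Q − 1`, bench margin ≥ .50·(Hs/s)²).
KNOWN EXPOSURE (ρ4, the corner): a co-signed regular field sustained at one survivor drives `g_eff → |g| + RB`; at `2η/s` the sink rate is 1/4 = the
purse-exhausting rate, where SURV(c, 0) (c > 1/4) and FIT⁗ (c ≥ 1/4) have no common window — inherent to any ceiling-priced law; crit-1 holds the question.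

**KERNEL (§4, K, sorry-free).**  `restRateBotPQ_of_survivor : 0 < c → SURV → LIFT → FIT⁗ → RestRateBotPQ halfPurse` (pick a survivor at the charged
level, drop `Im²`, divide by `c`: `k ≤ (η²Hs²/s² + aH)/c`; count ≤ k+1; signed drops ≥ −aY; credits ≥ 0) — it replaces the binder
`hR : RhW08.RateSplit.RateLawsHalfQ` of `RhW08.Lens1Coverage.TiltedLandingLaw421R_of_regHungCut10S` exactly as v3's converter did; read-back
`law421R_of_survivor` concludes the crux decl `…Theses.EarlyAppointments.TiltedLandingLaw421R` BY NAME from `TopPinning`, `RegUmbrella11S` and the three laws.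
WORKFILE / image candidate, registry-neutral: the skeleton OF RECORD stays `Lines/trkD_v11q.lean` e5f3c2cea72a0413; nothing here is a registry stub.  ONE TREE import
`…R3Lens1Pinning` (as v3).  HONEST LABEL: SURV, LIFT, FIT⁗ are OPEN; only §2/§4 are K.  Nothing here bears on the truth of RH; RH is not proved;
33346/33347 OPEN; checked ≠ landed ≠ proved. -/

namespace RhW08.TrackedWindow

open Complex
open RhW08.Round1 RhW08.StSwap RhW08.Round2 RhW08.QuadW RhW08.SealSwapQ RhW08.PurseP RhIdea6.G17.W07C7 RhIdea6.G17.W07C7.Rev6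
open RhW08.SealSwap (PBot)
open RhIdea6.G18.W07C8.Law421BirthS RhIdea6.G19.W07C11.Seam RhIdea6.G20.W07C12.Frac RhIdea6.G20.W07C12.StColP RhW07.C12.FieldSplit RhW07.C14.TwoSided RhW07.C14.Classes

/-! ## §1 The tracker T2 (Set-valued definitions; the kernel needs membership only) -/

/-- (T1) the KIDS of `v` at level `j`: the upper zeros of `f^{(j+1)}` in `v`'s closed Jensen disc. -/
def kidsQ (f : ℂ → ℂ) (j : ℕ) (v : ℂ) : Set ℂ := {w : ℂ | iteratedDeriv (j + 1) f w = 0 ∧ 0 < w.im ∧ NestedStep v w}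

/-- (T1) the total tie-break order among kids of `v`: nearer to `v`; ties smaller `re`; then `im ≤`. -/
def KidKeyLEQ (v w w' : ℂ) : Prop :=
  normSq (w - v) < normSq (w' - v) ∨ (normSq (w - v) = normSq (w' - v) ∧ (w.re < w'.re ∨ (w.re = w'.re ∧ w.im ≤ w'.im)))

/-- (T1) `w` is the KEY-MINIMAL element of `S` seen from `v` (a member preceding every member in the tie-break order). -/
def IsKeyMinQ (v : ℂ) (S : Set ℂ) (w : ℂ) : Prop := w ∈ S ∧ ∀ w' ∈ S, KidKeyLEQ v w w'

/-- (K) key-minimal elements are unique (the key is a total order). -/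
theorem isKeyMinQ_unique {v : ℂ} {S : Set ℂ} {w₁ w₂ : ℂ} (h₁ : IsKeyMinQ v S w₁) (h₂ : IsKeyMinQ v S w₂) : w₁ = w₂ := by
  have a := h₁.2 w₂ h₂.1
  have b := h₂.2 w₁ h₁.1
  simp only [KidKeyLEQ] at a b
  apply Complex.ext
  · rcases a with a | ⟨ha, a | ⟨ha', a'⟩⟩ <;> rcases b with b | ⟨hb, b | ⟨hb', b'⟩⟩ <;> linarith
  · rcases a with a | ⟨ha, a | ⟨ha', a'⟩⟩ <;> rcases b with b | ⟨hb, b | ⟨hb', b'⟩⟩ <;> linarith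

/-- (T1″, CUT 47) the ADOPTION candidates of `v` at level `j` (consulted only when `v` has NO kid): the level-(j+1) BAND states not higher than `v`. -/
def adoptQ (η : ℝ) (f : ℂ → ℂ) (x₀ s hmax R Hs : ℝ) (B : ℕ) (j : ℕ) (v : ℂ) : Set ℂ :=
  {w : ℂ | StTrkDQ η f x₀ s hmax R Hs B (j + 1) w ∧ w.im ≤ v.im}

/-- (T1″) `w` is THE HEIR of `v` at level `j`: the nearest KID (key-minimal in `kidsQ`); if `v` has no kid at all, the nearest ADOPTION candidate. -/
def IsHeirQ (η : ℝ) (f : ℂ → ℂ) (x₀ s hmax R Hs : ℝ) (B : ℕ) (j : ℕ) (v w : ℂ) : Prop :=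
  IsKeyMinQ v (kidsQ f j v) w ∨ ((∀ u, u ∉ kidsQ f j v) ∧ IsKeyMinQ v (adoptQ η f x₀ s hmax R Hs B j v) w)

/-- (K) at most ONE heir per member (the two tiers are exclusive; each tier has a unique key-minimal element). -/
theorem isHeirQ_unique {η : ℝ} {f : ℂ → ℂ} {x₀ s hmax R Hs : ℝ} {B j : ℕ} {v w₁ w₂ : ℂ} (h₁ : IsHeirQ η f x₀ s hmax R Hs B j v w₁)
    (h₂ : IsHeirQ η f x₀ s hmax R Hs B j v w₂) : w₁ = w₂ := by
  rcases h₁ with h₁ | ⟨hn₁, h₁⟩ <;> rcases h₂ with h₂ | ⟨hn₂, h₂⟩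
  · exact isKeyMinQ_unique h₁ h₂
  · exact absurd h₁.1 (hn₂ w₁)
  · exact absurd h₂.1 (hn₁ w₂)
  · exact isKeyMinQ_unique h₁ h₂

/-- (K) an heir is never higher than its parent (squares): a kid sits in the closed Jensen disc, an adopted state is lower by definition and upper. -/
theorem im_sq_le_of_isHeirQ {η : ℝ} {f : ℂ → ℂ} {x₀ s hmax R Hs : ℝ} {B j : ℕ} {v w : ℂ} (h : IsHeirQ η f x₀ s hmax R Hs B j v w) :
    w.im ^ 2 ≤ v.im ^ 2 := by
  rcases h with ⟨hk, -⟩ | ⟨-, ha, -⟩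
  · have hn := hk.2.2; unfold NestedStep at hn; nlinarith [sq_nonneg (w.re - v.re)]
  · have h0 : 0 < w.im := ha.1.2.2.1
    nlinarith [ha.2]

open Classical in

/-- (T2) the HEIRS of a set `S` of level-`j` members: the level-(j+1) points that are THE heir of some member (shared heirs merge). -/
def heirsQ (η : ℝ) (f : ℂ → ℂ) (x₀ s hmax R Hs : ℝ) (B : ℕ) (j : ℕ) (S : Set ℂ) : Set ℂ :=
  {w : ℂ | ∃ v ∈ S, IsHeirQ η f x₀ s hmax R Hs B j v w}

/-- (T2) the RE-SEED set of level `j`: the band-LOWEST state(s) of `StTrkDQ … j` (tree `IsLowest`). -/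
def reseedQ (η : ℝ) (f : ℂ → ℂ) (x₀ s hmax R Hs : ℝ) (B : ℕ) (j : ℕ) : Set ℂ :=
  {w : ℂ | IsLowest StTrkDQ η f x₀ s hmax R Hs B j w}

/-- (T2) THE TRACKED POPULATION `popQ … j : Set ℂ`: level 0 = all band states; level `j+1` = the heirs of the level-`j` members, and — ONLY when there is
no heir at all (every lineage ends) — the band-lowest state(s) of level `j+1` (RE-SEED). -/
def popQ (η : ℝ) (f : ℂ → ℂ) (x₀ s hmax R Hs : ℝ) (B : ℕ) : ℕ → Set ℂ
  | 0 => {u : ℂ | StTrkDQ η f x₀ s hmax R Hs B 0 u}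
  | j + 1 => heirsQ η f x₀ s hmax R Hs B j (popQ η f x₀ s hmax R Hs B j) ∪
      {w : ℂ | w ∈ reseedQ η f x₀ s hmax R Hs B (j + 1) ∧ heirsQ η f x₀ s hmax R Hs B j (popQ η f x₀ s hmax R Hs B j) = ∅}

/-- (T2, bench books) the LINEAGE of a root `u`: `u` itself at level 0, then heirs of heirs (ends when an heir fails to exist; never re-seeded). -/
def descQ (η : ℝ) (f : ℂ → ℂ) (x₀ s hmax R Hs : ℝ) (B : ℕ) (u : ℂ) : ℕ → Set ℂ
  | 0 => {u}
  | j + 1 => heirsQ η f x₀ s hmax R Hs B j (descQ η f x₀ s hmax R Hs B u j)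

/-! ## §2 (K) structure lemmas: membership, band states, survivors exist at charged levels, lineages sit inside the population -/

/-- (K) level-0 membership IS being a level-0 band state. -/
theorem mem_popQ_zero {η : ℝ} {f : ℂ → ℂ} {x₀ s hmax R Hs : ℝ} {B : ℕ} {w : ℂ} :
    w ∈ popQ η f x₀ s hmax R Hs B 0 ↔ StTrkDQ η f x₀ s hmax R Hs B 0 w := Iff.rfl

/-- (K) level-(j+1) membership: an heir of a level-`j` member, or (no heirs at all) a re-seeded band-lowest state. -/
theorem mem_popQ_succ {η : ℝ} {f : ℂ → ℂ} {x₀ s hmax R Hs : ℝ} {B j : ℕ} {w : ℂ} :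
    w ∈ popQ η f x₀ s hmax R Hs B (j + 1) ↔
      (∃ v ∈ popQ η f x₀ s hmax R Hs B j, IsHeirQ η f x₀ s hmax R Hs B j v w) ∨
        (IsLowest StTrkDQ η f x₀ s hmax R Hs B (j + 1) w ∧ heirsQ η f x₀ s hmax R Hs B j (popQ η f x₀ s hmax R Hs B j) = ∅) := Iff.rfl

/-- (K) every tracked member at level `j` is a level-`j` BAND state (kid: `RhW08.SuccB.stTrkDQ_succ_of_nested`; adoptee and re-seed: by definition). -/
theorem stTrkDQ_of_mem_popQ {η : ℝ} {f : ℂ → ℂ} {x₀ s hmax R Hs : ℝ} {B : ℕ} (hE : EngineHyps5 2 η f x₀ s hmax R Hs B) :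
    ∀ (j : ℕ) (w : ℂ), w ∈ popQ η f x₀ s hmax R Hs B j → StTrkDQ η f x₀ s hmax R Hs B j w := by
  intro j
  induction j with
  | zero => intro w hw; exact mem_popQ_zero.1 hw
  | succ j ih =>
    intro w hw
    rcases mem_popQ_succ.1 hw with ⟨v, hv, hheir⟩ | ⟨hlow, -⟩
    · rcases hheir with ⟨hk, -⟩ | ⟨-, ha, -⟩
      · exact RhW08.SuccB.stTrkDQ_succ_of_nested hE (ih v hv) hk.1 hk.2.1 hk.2.2
      · exact ha.1
    · exact hlow.1

/-- ★ (K) **SURVIVORS EXIST AT CHARGED LEVELS** — a charged level has a lowest band state (`Charged`), which is a level-0 member at `k = 0`, and at `k = j+1` is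
re-seeded whenever no heir exists.  This is what closes CAND-11's hole (H-a). -/
theorem popQ_nonempty_of_charged {η : ℝ} {f : ℂ → ℂ} {x₀ s hmax R Hs : ℝ} {B k : ℕ}
    (hk : Charged (PTrkSQ PBot) StTrkDQ ReadyR2 η f x₀ s hmax R Hs B k) : (popQ η f x₀ s hmax R Hs B k).Nonempty := by
  obtain ⟨v, hlow, -, -⟩ := hk
  cases k with
  | zero => exact ⟨v, mem_popQ_zero.2 hlow.1⟩
  | succ j =>
    by_cases h : heirsQ η f x₀ s hmax R Hs B j (popQ η f x₀ s hmax R Hs B j) = ∅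
    · exact ⟨v, mem_popQ_succ.2 (Or.inr ⟨hlow, h⟩)⟩
    · obtain ⟨w, u, hu, hw⟩ := Set.nonempty_iff_ne_empty.2 h
      exact ⟨w, mem_popQ_succ.2 (Or.inl ⟨u, hu, hw⟩)⟩

/-- (K) a survivor's energy depth below the ceiling never decreases along an heir step (the mechanism lemma behind SURV: `Im heir ≤ Im parent`). -/
theorem depth_mono_of_isHeirQ {η : ℝ} {f : ℂ → ℂ} {x₀ s hmax R Hs : ℝ} {B j : ℕ} {v w : ℂ} (h : IsHeirQ η f x₀ s hmax R Hs B j v w) :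
    η ^ 2 * (Hs ^ 2 - v.im ^ 2) / s ^ 2 ≤ η ^ 2 * (Hs ^ 2 - w.im ^ 2) / s ^ 2 :=
  div_le_div_of_nonneg_right (mul_le_mul_of_nonneg_left (by linarith [im_sq_le_of_isHeirQ h]) (sq_nonneg η)) (sq_nonneg s)

/-- (K) a lineage sits inside the population as long as it lives: `descQ u j ⊆ popQ j` for every level-0 member `u`. -/
theorem descQ_subset_popQ {η : ℝ} {f : ℂ → ℂ} {x₀ s hmax R Hs : ℝ} {B : ℕ} {u : ℂ} (hu : u ∈ popQ η f x₀ s hmax R Hs B 0) :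
    ∀ j : ℕ, descQ η f x₀ s hmax R Hs B u j ⊆ popQ η f x₀ s hmax R Hs B j := by
  intro j
  induction j with
  | zero => intro w hw; have : w = u := hw; exact this ▸ hu
  | succ j ih =>
    rintro w ⟨v, hv, hheir⟩
    exact mem_popQ_succ.2 (Or.inl ⟨v, ih hv, hheir⟩)

/-! ## §3 The laws (typed OPEN bench items) -/

/-- ★ SURV — **SURVIVOR DEPTH LAW** (OPEN): at every charged level `k`, every tracked survivor `w ∈ popQ k` lies at energy depth `≥ c·k − aH` below the
ceiling: `c·k ≤ η²(Hs² − Im w²)/s² + aH`.  Constants of record (CA849): `c = 1/2`, `aH = budgetConst 0` (bench c_max = .9925; NEVER type `c = 1`). -/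
def SurvivorLawQ (c : ℝ) (aH : Budget) : Prop :=
  ∀ (η : ℝ) (f : ℂ → ℂ) (x₀ s hmax R Hs : ℝ) (B : ℕ), EngineHyps5 2 η f x₀ s hmax R Hs B →
    ∀ k : ℕ, Charged (PTrkSQ PBot) StTrkDQ ReadyR2 η f x₀ s hmax R Hs B k →
      ∀ w ∈ popQ η f x₀ s hmax R Hs B k, c * (k : ℝ) ≤ η ^ 2 * (Hs ^ 2 - w.im ^ 2) / s ^ 2 + aH η f x₀ s hmax R Hs B

/-- ★ LIFT — **CHARGED LIFT LAW** (OPEN; v3 VERBATIM; HEIGHT currency, signed and cumulative): the charged levels below a charged level never raise the lowest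
band height by more than `aY·s/4` in aggregate, i.e. `−aY ≤ chargedDropSumQ (k+1)`.  Constant of record: `aY = halfBudget`. -/
def ChargedLiftLawQ (aY : Budget) : Prop :=
  ∀ (η : ℝ) (f : ℂ → ℂ) (x₀ s hmax R Hs : ℝ) (B : ℕ), EngineHyps5 2 η f x₀ s hmax R Hs B →
    ∀ k : ℕ, Charged (PTrkSQ PBot) StTrkDQ ReadyR2 η f x₀ s hmax R Hs B k →
      - aY η f x₀ s hmax R Hs B ≤ chargedDropSumQ η f x₀ s hmax R Hs B (k + 1)

/-- FIT⁗ — **THE PURSE INEQUALITY** (OPEN bench item, CLOSED FORM per legal charged frame, no tracker inside; support-level): the ceiling horizon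
`(η²Hs²/s² + aH)/c`, one level, and the lift allowance fit in the level-0 slack of the ½-purse: `(η²Hs²/s² + aH)/c + 1 + aY ≤ slackPQ halfPurse`. -/
def PurseFitQ (c : ℝ) (aH aY : Budget) : Prop :=
  ∀ (η : ℝ) (f : ℂ → ℂ) (x₀ s hmax R Hs : ℝ) (B : ℕ), EngineHyps5 2 η f x₀ s hmax R Hs B →
    ∀ k : ℕ, Charged (PTrkSQ PBot) StTrkDQ ReadyR2 η f x₀ s hmax R Hs B k →
      (η ^ 2 * Hs ^ 2 / s ^ 2 + aH η f x₀ s hmax R Hs B) / c + 1 + aY η f x₀ s hmax R Hs B ≤ slackPQ halfPurse η f x₀ s hmax R Hs B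

/-! ## §4 (K) THE CONVERTER: SURV + LIFT + FIT⁗ ⇒ the rate half at the ½-purse -/

open Classical in
/-- (K) bookkeeping: at most `k` charged levels below `k`. -/
theorem chargeCount_le_levelQ (P St Ready : StatePred) (η : ℝ) (f : ℂ → ℂ) (x₀ s hmax R Hs : ℝ) (B k : ℕ) :
    chargeCount P St Ready η f x₀ s hmax R Hs B k ≤ (k : ℝ) := by
  unfold chargeCount
  have h : ∀ j ∈ Finset.range k, (if Charged P St Ready η f x₀ s hmax R Hs B j then (1 : ℝ) else 0) ≤ 1 := fun j _ => by split_ifs <;> norm_num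
  exact (Finset.sum_le_sum h).trans (by simp)

/-- ★★★ (K) **THE SURVIVOR-BOOKS CONVERTER** — `0 < c → SURV → LIFT → FIT⁗ → RestRateBotPQ halfPurse`.
At a charged `k` a survivor `w ∈ popQ k` exists (`popQ_nonempty_of_charged`); SURV and `Im w² ≥ 0` give `c·k ≤ η²Hs²/s² + aH`, so `k ≤ (η²Hs²/s² + aH)/c`,
and FIT⁗ gives `k + 1 ≤ slack_½ − aY`; then `netCost_all (k+1) = chargeCount (k+1) − chargedDropSum (k+1) ≤ (k+1) + aY ≤ slack_½ ≤ slack_½ + credits (k+1)`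
— the step form `restRateBotPQ_iff_books_step halfPurse` (INIT from `typedPurse ≤ halfPurse`). -/
theorem restRateBotPQ_of_survivor {c : ℝ} {aH aY : Budget} (hc : 0 < c) (hS : SurvivorLawQ c aH)
    (hY : ChargedLiftLawQ aY) (hfit : PurseFitQ c aH aY) : RestRateBotPQ halfPurse := by
  rw [restRateBotPQ_iff_books_step]
  intro η f x₀ s hmax R Hs B hE
  refine ⟨slackPQ_nonneg_of_typed_le hE (typedPurse_le_halfPurse f x₀ s hmax R Hs B), fun k hk => ?_⟩
  obtain ⟨w, hw⟩ := popQ_nonempty_of_charged hk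
  have hSk := hS η f x₀ s hmax R Hs B hE k hk w hw
  have hYk := hY η f x₀ s hmax R Hs B hE k hk
  have hfitk := hfit η f x₀ s hmax R Hs B hE k hk
  -- (1) drop the survivor's own height: depth ≤ the full ceiling horizon
  have h1 : η ^ 2 * (Hs ^ 2 - w.im ^ 2) / s ^ 2 ≤ η ^ 2 * Hs ^ 2 / s ^ 2 :=
    div_le_div_of_nonneg_right (mul_le_mul_of_nonneg_left (by nlinarith [sq_nonneg w.im]) (sq_nonneg η)) (sq_nonneg s)
  -- (2) SURV ⇒ `k ≤ (η²Hs²/s² + aH)/c`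
  have hk1 : (k : ℝ) ≤ (η ^ 2 * Hs ^ 2 / s ^ 2 + aH η f x₀ s hmax R Hs B) / c := by
    rw [le_div_iff₀ hc]
    linarith
  -- (3) the books: count ≤ k+1, the signed charged drops ≥ −aY, credits ≥ 0, FIT⁗
  have hcount := chargeCount_le_levelQ (PTrkSQ PBot) StTrkDQ ReadyR2 η f x₀ s hmax R Hs B (k + 1)
  push_cast at hcount
  have hcr := creditsQ_nonneg η f x₀ s hmax R Hs B (k + 1)
  rw [netCostQ_all_eq]
  linarith

/-- ★★ READ-BACK (K modulo the NAMED hypotheses): the CRUX DECL BY NAME from the two registry SUCC stubs (`TopPinning`, `RegUmbrella11S`, shared with v11q)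
and the three survivor-books laws — `restRateBotPQ_of_survivor` sits exactly where `RhW08.RateSplit.restRateBotPQ_half_of_rateLaws hR` sat. -/
theorem law421R_of_survivor {c : ℝ} {aH aY : Budget} (hP : RhW08.Lens1Pinning.TopPinning) (hU : RhW08.Lens1Pinning.RegUmbrella11S)
    (hc : 0 < c) (hS : SurvivorLawQ c aH) (hY : ChargedLiftLawQ aY) (hfit : PurseFitQ c aH aY) :
    Summit.RiemannHypothesis.RiemannHypothesis.Theses.EarlyAppointments.TiltedLandingLaw421R :=
  law421Half_of_succ_rate (RhW08.Lens1Coverage.restSuccBotQ_of_resS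
      (RhW08.Lens1Coverage.regRes8S_of_regHungCut10S (RhW08.Lens1Pinning.regHungCut10S_of_topPinning hP hU)))
    (restRateBotPQ_of_survivor hc hS hY hfit)

/-- (K) the same at the constants-of-record rate `c = 1/2` (CA849), the scalar side-condition discharged. -/
theorem law421R_of_survivor_half {aH aY : Budget} (hP : RhW08.Lens1Pinning.TopPinning) (hU : RhW08.Lens1Pinning.RegUmbrella11S)
    (hS : SurvivorLawQ (1 / 2) aH) (hY : ChargedLiftLawQ aY) (hfit : PurseFitQ (1 / 2) aH aY) :
    Summit.RiemannHypothesis.RiemannHypothesis.Theses.EarlyAppointments.TiltedLandingLaw421R :=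
  law421R_of_survivor hP hU one_half_pos hS hY hfit

end RhW08.TrackedWindow
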